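import Summits.KontsevichZagierPeriods.KontsevichZagierPeriods.Theorems.FurushoPentagonPentagonInKZRegEndCons
import Literature.NumberTheory.Transcendental.DrinfeldAssociatorRegularisation
import Literature.NumberTheory.Transcendental.Associators

/-!
# `PentagonInKZ`, line `edge-normal-newton-leibniz`: corner engine — the edge centrality at
abscissa `0` for the regularised vertical series

Stub `cornerEngine_centralV` of the crux `FurushoPentagon.PentagonInKZ`
(stmt-KontsevichZagierPeriods-11348).

THE EDGE CENTRALITY AT THE SERIES LEVEL.  The corner principle assumes, at abscissa `ξ = 0`, the
two centralities `[Z₀, Z₁] = 0` and `Σ_l g_l(0,s) · [Z₀, Z_l] = 0` for `s ∈ (0, β)`, in functional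
form: for a `ℚ`-linear functional `μ` on `DK_N(ℚ)` and all context factors `P, Q`,
`μ(P [Zq₀, Zq₁] Q) = 0` and `Σ_l gd l 0 s · μ(P [Zq₀, Zq_l] Q) = 0`.  The conclusion is the
centrality of the log-free vertical transport at abscissa `0`,
`Σ_{V : Fin l → L} μ(P [Zq₀, wZ V] Q) · Vt V y 0 η = 0` for `y` in the open cube and `η ∈ (0, β]`,
where `wZ V = Zq_{V₀} ⋯ Zq_{V_{l-1}}` and `Vt V y 0 η = Σ_v ⟨regEnd₁ V, v⟩ · qV v y 0 η`.

PROOF (Leibniz induction on the length `l`).  For `l = 0`, `wZ V = 1` commutes with `Zq₀`.  For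
`l + 1`, peel the outermost letter (inline form of `CornerEnginePeel.peel` / `prod_peel` of the
stub `cornerEngine_peel`, via the first-letter stripping rule `regEnd_apply_cons`): with
`h_b = [b = 1 ? 1/y₀ : η · gd b 0 (η y₀)]`,
`Σ_V μ(P [Zq₀, wZ V] Q) Vt V (y₀ y') 0 η
   = Σ_b h_b Σ_{V'} μ(P [Zq₀, Zq_b wZ V'] Q) Vt V' y' 0 (η y₀)
     − h_1 Σ_{V'} μ(P [Zq₀, wZ V' Zq₁] Q) Vt V' y' 0 (η y₀)`.
By the Leibniz rule `[Zq₀, Zq_b wZ V'] = [Zq₀, Zq_b] wZ V' + Zq_b [Zq₀, wZ V']` and the induction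
hypothesis (context `P Zq_b`, dilated height `η y₀ ∈ (0, β]`), the first inner sum is
`Σ_{V'} μ(P [Zq₀, Zq_b] wZ V' Q) Vt V' …`; by
`[Zq₀, wZ V' Zq₁] = [Zq₀, wZ V'] Zq₁ + wZ V' [Zq₀, Zq₁]`, the induction hypothesis (context
`Zq₁ Q`) and the first centrality, the second sum vanishes.
Finally, for every `V'`, `Σ_b h_b μ(P [Zq₀, Zq_b] wZ V' Q) = η Σ_b gd b 0 (η y₀) μ(…) = 0`: the
`b = 1` term is `0` on both sides by the first centrality, and the sum is the second centrality at
`s = η y₀ ∈ (0, β)`.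

References: V. G. Drinfeld, Leningrad Math. J. 2 (1991), §2 (the edges of the pentagon cell);
K. Ihara, M. Kaneko, D. Zagier, Compos. Math. 142 (2006), §3, Cor. 5.
-/

noncomputable section

open scoped BigOperators
open Literature.NumberTheory.Transcendental

namespace Summit.KontsevichZagierPeriods.FurushoPentagon.PentagonInKZ

namespace CornerEngineCentralV

/-- Leibniz rule in context, left letter: `P [Z, a W] Q = P [Z, a] (W Q) + (P a) [Z, W] Q`.
[folklore] -/
theorem ctx_comm_mul_left {A : Type*} [Ring A] (P Q Z a W : A) :
    P * (Z * (a * W) - a * W * Z) * Q =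
      P * (Z * a - a * Z) * (W * Q) + P * a * (Z * W - W * Z) * Q := by
  noncomm_ring

/-- Leibniz rule in context, right letter: `P [Z, W b] Q = P [Z, W] (b Q) + (P W) [Z, b] Q`.
[folklore] -/
theorem ctx_comm_mul_right {A : Type*} [Ring A] (P Q Z W b : A) :
    P * (Z * (W * b) - W * b * Z) * Q =
      P * (Z * W - W * Z) * (b * Q) + P * W * (Z * b - b * Z) * Q := by
  noncomm_ring

/-- Exchange of two finite sums: if `Σ_a h a · c a k = 0` for every `k`, then
`Σ_a h a · Σ_k c a k · T k = 0`. [folklore] -/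
theorem sum_mul_sum_eq_zero {ι κ : Type*} [Fintype ι] [Fintype κ] {h : ι → ℝ} {c : ι → κ → ℝ}
    {T : κ → ℝ} (hD : ∀ k, ∑ a, h a * c a k = 0) : ∑ a, h a * ∑ k, c a k * T k = 0 := by
  calc ∑ a, h a * ∑ k, c a k * T k = ∑ k, (∑ a, h a * c a k) * T k := by
        simp_rw [Finset.mul_sum, Finset.sum_mul, mul_assoc]
        exact Finset.sum_comm
    _ = 0 := Finset.sum_eq_zero fun k _ => by rw [hD, zero_mul]

end CornerEngineCentralV

open CornerEngineCentralV in
/-- **Stub `cornerEngine_centralV`** — the edge centrality at abscissa `0` for the end-regularised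
vertical series of the corner engine.  With the dictionary of the engine (letter densities `gd`,
dilated cubical word integrands `qV`, end-regularised integrands `Vt V y ξ η = Σ_v ⟨regEnd₁ V, v⟩
qV v y ξ η`, residue monomials `wZ U = Zq_{U₀} ⋯ Zq_{U_{k-1}}`), a `ℚ`-linear functional `μ` on
`DK_N(ℚ)` killing `P [Zq₀, Zq₁] Q` and `Σ_l gd l 0 s · P [Zq₀, Zq_l] Q` (`s ∈ (0, β)`) for all
contexts `P, Q` kills `Σ_V P [Zq₀, wZ V] Q · Vt V y 0 η` for `y` in the open cube and
`0 < η ≤ β`: `[Z₀, V_0(η)] = 0` for the log-free vertical transport at abscissa `0`.  Leibniz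
induction on the word length, peeling the outermost letter (first-letter stripping rule
`regEnd_apply_cons` of the end regularisation, as in the stub `cornerEngine_peel`).
[cite: Drinfeld1991, §2] -/
theorem cornerEngine_centralV :
    ∀ (m : ℕ) (cf : Fin (m + 2) → Fin 4 → ℚ) (β : ℚ) (N : ℕ) (nZ : Fin (m + 2) → Fin 4 → Fin 4 → ℤ) (gd : Fin (m + 2) → ℝ → ℝ → ℝ) (hgd : ∀ k x s, gd k x s = ((cf k 2 : ℝ) + (cf k 3 : ℝ) * x) / ((cf k 0 : ℝ) + (cf k 1 : ℝ) * x + (cf k 2 : ℝ) * s + (cf k 3 : ℝ) * x * s)) (qV : ∀ {n : ℕ}, (Fin n → Fin (m + 2)) → (Fin n → ℝ) → ℝ → ℝ → ℝ) (hqV : ∀ {n : ℕ} (v : Fin n → Fin (m + 2)) (y : Fin n → ℝ) (ξ η : ℝ), qV v y ξ η = ∏ i, if v i = 1 then 1 / y i else (η * ∏ j ∈ Finset.univ.filter (fun j => j < i), y j) * gd (v i) ξ (η * ∏ j ∈ Finset.univ.filter (fun j => j ≤ i), y j)) (Vt : ∀ {n : ℕ}, (Fin n → Fin (m + 2)) →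 (Fin n → ℝ) → ℝ → ℝ → ℝ) (hVt : ∀ {n : ℕ} (V : Fin n → Fin (m + 2)) (y : Fin n → ℝ) (ξ η : ℝ), Vt V y ξ η = ∑ v : Fin n → Fin (m + 2), (Shuffle.regEnd (1 : Fin (m + 2)) (List.ofFn V) (List.ofFn v) : ℝ) * qV v y ξ η) (wZ : ∀ {n : ℕ}, (Fin n → Fin (m + 2)) → DrinfeldKohnoTrunc ℚ (Fin 4) N) (hwZ : ∀ {n : ℕ} (U : Fin n → Fin (m + 2)), wZ U = ((List.ofFn U).map fun k => ∑ i : Fin 4, ∑ j : Fin 4, (nZ k i j : ℚ) • DrinfeldKohnoTrunc.t ℚ N i j).prod) (Zq : Fin (m + 2) → DrinfeldKohnoTrunc ℚ (Fin 4) N) (hZq : ∀ k, Zq k = (∑ i : Fin 4, ∑ j : Fin 4, (nZ k i j : ℚ) • DrinfeldKohnoTrunc.t ℚ N i j)) (μ : DrinfeldKohnoTrunc ℚ (Fin 4) N →ₗ[ℚ] ℚ), (∀ P Q : DrinfeldKohnoTrunc ℚ (Fin 4) N, μ (P * (Zq 0 * Zq 1 - Zq 1 * Zq 0) * Q) = 0)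 → (∀ s : ℝ, 0 < s → s < (β : ℝ) → ∀ P Q : DrinfeldKohnoTrunc ℚ (Fin 4) N, ∑ l : Fin (m + 2), gd l 0 s * (μ (P * (Zq 0 * Zq l - Zq l * Zq 0) * Q) : ℝ) = 0) → ∀ {l : ℕ} (P Q : DrinfeldKohnoTrunc ℚ (Fin 4) N) (y : Fin l → ℝ) (η : ℝ), (∀ i, 0 < y i ∧ y i < 1) → 0 < η → η ≤ (β : ℝ) → ∑ V : Fin l → Fin (m + 2), (μ (P * (Zq 0 * wZ V - wZ V * Zq 0) * Q) : ℝ) * Vt V y 0 η = 0 := by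
  intro m cf β N nZ gd _ qV hqV Vt hVt wZ hwZ Zq hZq μ h01 hsum
  -- residue monomials of `a U'` and `U' b`
  have ofFn_snoc : ∀ {k : ℕ} (U' : Fin k → Fin (m + 2)) (b : Fin (m + 2)),
      List.ofFn (Fin.snoc U' b : Fin (k + 1) → Fin (m + 2)) = List.ofFn U' ++ [b] := fun U' b => by
    rw [List.ofFn_succ_last]
    simp only [Fin.snoc_castSucc, Fin.snoc_last]
  have hwZ_cons : ∀ {k : ℕ} (a : Fin (m + 2)) (U' : Fin k → Fin (m + 2)),
      wZ (Fin.cons a U') = Zq a * wZ U' := fun a U' => by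
    rw [hwZ, hwZ, List.ofFn_cons, List.map_cons, List.prod_cons, hZq]
  have hwZ_snoc : ∀ {k : ℕ} (U' : Fin k → Fin (m + 2)) (b : Fin (m + 2)),
      wZ (Fin.snoc U' b) = wZ U' * Zq b := fun U' b => by
    rw [hwZ, hwZ, ofFn_snoc, List.map_append, List.prod_append, List.map_singleton,
      List.prod_singleton, hZq]
  -- splitting sums over `(k+1)`-tuples off the first / last letter
  have sum_cons : ∀ {k : ℕ} (f : (Fin (k + 1) → Fin (m + 2)) → ℝ),
      ∑ u, f u = ∑ a, ∑ u' : Fin k → Fin (m + 2), f (Fin.cons a u') := fun f => by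
    rw [← (Fin.consEquiv fun _ => Fin (m + 2)).sum_comp f, Fintype.sum_prod_type]
    rfl
  have sum_snoc : ∀ {k : ℕ} (f : (Fin (k + 1) → Fin (m + 2)) → ℝ),
      ∑ u, f u = ∑ u' : Fin k → Fin (m + 2), ∑ b, f (Fin.snoc u' b) := fun f => by
    rw [← (Fin.snocEquiv fun _ => Fin (m + 2)).sum_comp f, Fintype.sum_prod_type_right]
    rfl
  intro l
  induction l with
  | zero =>
    intro P Q y η _ _ _
    have h1 : ∀ V : Fin 0 → Fin (m + 2), wZ V = 1 := fun V => by
      rw [hwZ, List.ofFn_zero, List.map_nil, List.prod_nil]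
    simp [h1]
  | succ l ih =>
    intro P Q y η hy hη hηβ
    obtain ⟨y₀, y', rfl⟩ : ∃ (y₀ : ℝ) (y' : Fin l → ℝ), y = Fin.cons y₀ y' :=
      ⟨y 0, Fin.tail y, (Fin.cons_self_tail y).symm⟩
    have hy₀ : 0 < y₀ ∧ y₀ < 1 := by simpa using hy 0
    have hy' : ∀ i, 0 < y' i ∧ y' i < 1 := fun i => by simpa using hy i.succ
    have hs0 : 0 < η * y₀ := mul_pos hη hy₀.1
    have hsβ : η * y₀ < (β : ℝ) := (mul_lt_of_lt_one_right hη hy₀.2).trans_le hηβ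
    -- the outermost factor of the dilated cubical integrand
    set h : Fin (m + 2) → ℝ := fun b => if b = 1 then 1 / y₀ else η * gd b 0 (η * y₀) with hh
    have hQ : ∀ (b : Fin (m + 2)) (v' : Fin l → Fin (m + 2)),
        qV (Fin.cons b v') (Fin.cons y₀ y') 0 η = h b * qV v' y' 0 (η * y₀) := by
      intro b v'
      have plt0 : ∏ j ∈ Finset.univ.filter (fun j : Fin (l + 1) => j < 0),
          (Fin.cons y₀ y' : Fin (l + 1) → ℝ) j = 1 := by
        rw [Finset.prod_filter, Finset.prod_eq_one]
        intro j _
        rw [if_neg (Fin.not_lt_zero j)]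
      have ple0 : ∏ j ∈ Finset.univ.filter (fun j : Fin (l + 1) => j ≤ 0),
          (Fin.cons y₀ y' : Fin (l + 1) → ℝ) j = y₀ := by
        rw [Finset.prod_filter, Fin.prod_univ_succ, if_pos le_rfl, Finset.prod_eq_one, mul_one]
        · rfl
        intro j _
        rw [if_neg (not_le.mpr (Fin.succ_pos j))]
      have plts : ∀ i : Fin l, ∏ j ∈ Finset.univ.filter (fun j : Fin (l + 1) => j < i.succ),
          (Fin.cons y₀ y' : Fin (l + 1) → ℝ) j = y₀ * ∏ j ∈ Finset.univ.filter (fun j => j < i), y' j := by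
        intro i
        rw [Finset.prod_filter, Finset.prod_filter, Fin.prod_univ_succ, if_pos (Fin.succ_pos i),
          Fin.cons_zero]
        simp only [Fin.cons_succ, Fin.succ_lt_succ_iff]
      have ples : ∀ i : Fin l, ∏ j ∈ Finset.univ.filter (fun j : Fin (l + 1) => j ≤ i.succ),
          (Fin.cons y₀ y' : Fin (l + 1) → ℝ) j = y₀ * ∏ j ∈ Finset.univ.filter (fun j => j ≤ i), y' j := by
        intro i
        rw [Finset.prod_filter, Finset.prod_filter, Fin.prod_univ_succ, if_pos (Fin.succ_pos i).le,
          Fin.cons_zero]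
        simp only [Fin.cons_succ, Fin.succ_le_succ_iff]
      rw [hqV, hqV, Fin.prod_univ_succ]
      simp only [hh, Fin.cons_zero, Fin.cons_succ, plt0, ple0, plts, ples, mul_one, mul_assoc]
    -- peel the outermost letter, for the weight `V ↦ μ(P [Zq₀, wZ V] Q)`:
    -- split `v = b v'`, factorise `qV`, strip the first letter through `regEnd₁` …
    have hinner : ∀ V : Fin (l + 1) → Fin (m + 2),
        Vt V (Fin.cons y₀ y') 0 η =
          (∑ b, ∑ v' : Fin l → Fin (m + 2), ((if (List.ofFn V).head? = some b
              then Shuffle.regEnd (1 : Fin (m + 2)) (List.ofFn V).tail (List.ofFn v') else 0 : ℚ) : ℝ) *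
                (h b * qV v' y' 0 (η * y₀))) -
          ∑ b, ∑ v' : Fin l → Fin (m + 2), ((if b = 1 ∧ (List.ofFn V).getLast? = some 1
              then Shuffle.regEnd (1 : Fin (m + 2)) (List.ofFn V).dropLast (List.ofFn v') else 0 : ℚ) : ℝ) *
                (h b * qV v' y' 0 (η * y₀)) := by
      intro V
      rw [hVt, sum_cons, ← Finset.sum_sub_distrib]
      refine Finset.sum_congr rfl fun b _ => ?_
      rw [← Finset.sum_sub_distrib]
      refine Finset.sum_congr rfl fun v' _ => ?_
      rw [List.ofFn_cons, regEnd_apply_cons, hQ, Rat.cast_sub, sub_mul]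
    -- … and resum over `V = b V'` resp. `V = V' 1` (abstract weights `W`)
    have peel : ∀ (W : (Fin (l + 1) → Fin (m + 2)) → ℝ) (Wl : Fin (m + 2) → (Fin l → Fin (m + 2)) → ℝ)
        (Wr : (Fin l → Fin (m + 2)) → ℝ), (∀ b V', W (Fin.cons b V') = Wl b V') →
        (∀ V', W (Fin.snoc V' 1) = Wr V') →
        ∑ V, W V * Vt V (Fin.cons y₀ y') 0 η =
          (∑ b, h b * ∑ V', Wl b V' * Vt V' y' 0 (η * y₀)) -
            h 1 * ∑ V', Wr V' * Vt V' y' 0 (η * y₀) := by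
      intro W Wl Wr hWl hWr
      simp_rw [hinner, mul_sub, Finset.sum_sub_distrib]
      congr 1
      · rw [sum_cons]
        refine Finset.sum_congr rfl fun b₀ _ => ?_
        rw [Finset.mul_sum]
        refine Finset.sum_congr rfl fun V' _ => ?_
        have hhead : (List.ofFn (Fin.cons b₀ V' : Fin (l + 1) → Fin (m + 2))).head? = some b₀ := by
          rw [List.ofFn_cons, List.head?_cons]
        have htail :
            (List.ofFn (Fin.cons b₀ V' : Fin (l + 1) → Fin (m + 2))).tail = List.ofFn V' := by
          rw [List.ofFn_cons, List.tail_cons]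
        simp only [hhead, htail, Option.some.injEq, hWl, hVt]
        rw [Finset.sum_eq_single b₀ (fun b _ hb => ?_) (fun hb => absurd (Finset.mem_univ b₀) hb)]
        · simp only [if_true, Finset.mul_sum]
          refine Finset.sum_congr rfl fun v' _ => ?_
          ring
        · simp only [if_neg (Ne.symm hb), Rat.cast_zero, zero_mul, Finset.sum_const_zero]
      · rw [sum_snoc, Finset.mul_sum]
        refine Finset.sum_congr rfl fun V' _ => ?_
        have hlast : ∀ b : Fin (m + 2),
            (List.ofFn (Fin.snoc V' b : Fin (l + 1) → Fin (m + 2))).getLast? = some b := by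
          intro b; rw [ofFn_snoc, List.getLast?_concat]
        have hdrop : ∀ b : Fin (m + 2),
            (List.ofFn (Fin.snoc V' b : Fin (l + 1) → Fin (m + 2))).dropLast = List.ofFn V' := by
          intro b; rw [ofFn_snoc, List.dropLast_concat]
        simp only [hlast, hdrop, Option.some.injEq, hVt]
        rw [Finset.sum_eq_single 1 (fun b _ hb => ?_) (fun hc => absurd (Finset.mem_univ 1) hc)]
        · rw [hWr,
            Finset.sum_eq_single 1 (fun a _ ha => ?_) (fun hc => absurd (Finset.mem_univ 1) hc)]
          · simp only [and_self, if_true, Finset.mul_sum]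
            refine Finset.sum_congr rfl fun v' _ => ?_
            ring
          · simp only [ha, false_and, if_false, Rat.cast_zero, zero_mul, Finset.sum_const_zero]
        · simp only [hb, and_false, if_false, Rat.cast_zero, zero_mul, Finset.sum_const_zero,
            mul_zero]
    have key :
        ∑ V : Fin (l + 1) → Fin (m + 2), (μ (P * (Zq 0 * wZ V - wZ V * Zq 0) * Q) : ℝ) *
            Vt V (Fin.cons y₀ y') 0 η =
          (∑ b : Fin (m + 2), h b *
              ∑ V' : Fin l → Fin (m + 2),
                (μ (P * (Zq 0 * (Zq b * wZ V') - Zq b * wZ V' * Zq 0) * Q) : ℝ) *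
                  Vt V' y' 0 (η * y₀)) -
            h 1 *
              ∑ V' : Fin l → Fin (m + 2),
                (μ (P * (Zq 0 * (wZ V' * Zq 1) - wZ V' * Zq 1 * Zq 0) * Q) : ℝ) *
                  Vt V' y' 0 (η * y₀) :=
      peel (fun V => (μ (P * (Zq 0 * wZ V - wZ V * Zq 0) * Q) : ℝ))
        (fun b V' => (μ (P * (Zq 0 * (Zq b * wZ V') - Zq b * wZ V' * Zq 0) * Q) : ℝ))
        (fun V' => (μ (P * (Zq 0 * (wZ V' * Zq 1) - wZ V' * Zq 1 * Zq 0) * Q) : ℝ))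
        (fun b V' => by rw [hwZ_cons]) (fun V' => by rw [hwZ_snoc])
    -- the right piece: `[Zq₀, wZ V' Zq₁] = [Zq₀, wZ V'] Zq₁ + wZ V' [Zq₀, Zq₁]`
    have hR : ∑ V' : Fin l → Fin (m + 2),
        (μ (P * (Zq 0 * (wZ V' * Zq 1) - wZ V' * Zq 1 * Zq 0) * Q) : ℝ) *
          Vt V' y' 0 (η * y₀) = 0 := by
      refine Eq.trans (Finset.sum_congr rfl fun V' _ => ?_)
        (ih P (Zq 1 * Q) y' (η * y₀) hy' hs0 hsβ.le)
      rw [ctx_comm_mul_right, map_add, h01, add_zero]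
    -- the left pieces: `[Zq₀, Zq_b wZ V'] = [Zq₀, Zq_b] wZ V' + Zq_b [Zq₀, wZ V']`
    have hL : ∀ b : Fin (m + 2), ∑ V' : Fin l → Fin (m + 2),
        (μ (P * (Zq 0 * (Zq b * wZ V') - Zq b * wZ V' * Zq 0) * Q) : ℝ) * Vt V' y' 0 (η * y₀) =
        ∑ V' : Fin l → Fin (m + 2),
          (μ (P * (Zq 0 * Zq b - Zq b * Zq 0) * (wZ V' * Q)) : ℝ) * Vt V' y' 0 (η * y₀) := by
      intro b
      have h0 := ih (P * Zq b) Q y' (η * y₀) hy' hs0 hsβ.le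
      calc _ = ∑ V' : Fin l → Fin (m + 2),
            ((μ (P * (Zq 0 * Zq b - Zq b * Zq 0) * (wZ V' * Q)) : ℝ) * Vt V' y' 0 (η * y₀) +
              (μ (P * Zq b * (Zq 0 * wZ V' - wZ V' * Zq 0) * Q) : ℝ) * Vt V' y' 0 (η * y₀)) :=
            Finset.sum_congr rfl fun V' _ => by
              rw [ctx_comm_mul_left, map_add, Rat.cast_add, add_mul]
        _ = _ := by rw [Finset.sum_add_distrib, h0, add_zero]
    -- the two centralities at `s = η y₀ ∈ (0, β)`
    have hD : ∀ Q'' : DrinfeldKohnoTrunc ℚ (Fin 4) N,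
        ∑ b : Fin (m + 2), h b * (μ (P * (Zq 0 * Zq b - Zq b * Zq 0) * Q'') : ℝ) = 0 := by
      intro Q''
      calc _ = ∑ b : Fin (m + 2), η * (gd b 0 (η * y₀) *
              (μ (P * (Zq 0 * Zq b - Zq b * Zq 0) * Q'') : ℝ)) := by
            refine Finset.sum_congr rfl fun b _ => ?_
            simp only [hh]
            split_ifs with hb
            · subst hb
              simp only [h01, Rat.cast_zero, mul_zero]
            · ring
        _ = 0 := by rw [← Finset.mul_sum, hsum (η * y₀) hs0 hsβ P Q'', mul_zero]
    rw [key, hR, mul_zero, sub_zero]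
    calc _ = ∑ b : Fin (m + 2), h b *
          ∑ V' : Fin l → Fin (m + 2),
            (μ (P * (Zq 0 * Zq b - Zq b * Zq 0) * (wZ V' * Q)) : ℝ) * Vt V' y' 0 (η * y₀) :=
          Finset.sum_congr rfl fun b _ => by rw [hL b]
      _ = 0 := sum_mul_sum_eq_zero
          (c := fun b V' => (μ (P * (Zq 0 * Zq b - Zq b * Zq 0) * (wZ V' * Q)) : ℝ))
          fun V' => hD _

end Summit.KontsevichZagierPeriods.FurushoPentagon.PentagonInKZ
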